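import Summits.CriticalPhenomena.Ising3DConformalLimit.Theses.PerfectScreening
import Literature.Probability.LatticeModels.CriticalAxisRatioRegularity
import Literature.Probability.LatticeModels.PointwiseScalingLimitEtaExists
import Literature.Probability.LatticeModels.CriticalTwoPointLawDimension
import Literature.Probability.LatticeModels.LatticeLaplacianZd

/-!
# Disproof of `SubharmonicOffOrigin` — findings (cdisprove seat, cycle 1)

Crux `stmt-CriticalPhenomena-1341` (route `PerfectScreening`, decl `SubharmonicOffOrigin`, "SubH"):
`∀ x ≠ 0, 6·G(x) ≤ ∑ᵢ (G(x+eᵢ) + G(x−eᵢ))`, `G = criticalTwoPoint 3 = ⟨σ₀σ_x⟩⁺_{β_c(3)}`.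

## Verdict so far: NO KILL (and no Lean-level kill is possible)
* The statement is precise and junk-free: `criticalTwoPoint 3 x = twoPointPlus 3 (criticalBeta 3) x`, a
  `limUnder` of box expectations that provably exist (`hasBoxLimit_isingCorr_plus_holds`), at
  `criticalBeta 3 = sInf {β ≥ 0 | m*(β) > 0} ∈ (0,∞)`. No free parameter, normalisation or frame to
  degenerate; `G` is not computable, so `¬SubH` can only come from DATA (Monte Carlo), never from a
  kernel-checked witness. The numerical kill test is in flight (jobs below); its verdict goes to the item
  as evidence `compute-<id>.json`.
* SubH ⟺ `∀ x ≠ 0, 0 ≤ Δ_{ℤ³} G x` (`subharmonicOffOrigin_iff_laplacian_nonneg`, for provers).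

## (a) LOAD-BEARING ANALYSIS — the only hypothesis `x ≠ 0` is necessary
`subharmonicOffOrigin_false_without_neZero`: at `x = 0` the inequality reads `6 ≤ ∑ (G(±eᵢ))`, false
because `G(e₀) < 1` (`criticalTwoPoint_axis_one_lt_one`: log-convexity on the axis + `G → 0`).

## (b) TIGHTNESS — the constant `6` is sharp; SubH is an asymptotically SATURATED inequality
`eventually_nbrSum_axis_lt` (UNCONDITIONAL): for every `ε > 0`, eventually along the axis
`∑_nbrs G(n e₀) < (6+ε)·G(n e₀)` — from the tree theorem "axis ratios → 1"
(`criticalTwoPoint_axis_ratio_tendsto_one`, ADC21 log-convexity + Simon–Lieb) and Messager–Miracle-Solé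
(`criticalTwoPoint_axis_sandwich`: the four transverse neighbours of `n e₀` lie on the sup-sphere of
radius `n`). Consequences:
* `not_uniformlyStrictSubharmonic`: the natural strengthening `(6+ε)G ≤ ∑_nbrs G` (x ≠ 0) is FALSE for
  every `ε > 0` — "any proof must be an identity-level / exact-balance argument; every inequality with
  a uniform slack (Simon–Lieb, Gaussian domination with constant, tree comparisons) fails on the axis",
  now a theorem on `ℤ³` itself (the planner's no-go (B) was the Bethe-tree heuristic `D ≡ 0`).
* `tendsto_nbrSum_div_of_subharmonicOffOrigin` (CONDITIONAL): SubH ⟹ `∑_nbrs G(n e₀)/G(n e₀) → 6`,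
  i.e. `Δ G / G → 0` along the axis (exact balance is FORCED by SubH).

## (b′) QUANTITATIVE exact balance — the AXIS SUM RULE (elementary: MMS + Abel summation only)
With `M n = G(n e₀)`, axis Laplacian `Λ(m) = ∑_nbrs G(m e₀) − 6M(m)` and transverse deficit
`T(m) = 4M(m) − ∑_{4 transverse nbrs} G ≥ 0`: `Λ(m) + T(m) = δ²M(m)`, and (`axis_sum_rule`)
`∑_{n<N} (n+1)(Λ(n+1) + T(n+1)) + M N + N(M N − M(N+1)) = G(0) = 1` for every `N` (identity).
* `sum_weighted_axisLaplacian_lt_one` (UNCONDITIONAL): `∑_{n<N} (n+1)·Λ(n+1) < 1` for all `N`.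
* `weighted_axisLaplacian_of_subharmonicOffOrigin`: under SubH the terms are `≥ 0`, so
  `∑ₙ n·ΔG(n e₀) ≤ 1` converges — `liminf n² ΔG(ne₀) = 0`; numerically the transverse moments
  `∑ n·T(n) ≈ 4∑ n(G(n,0,0) − G(n,1,0))` eat most of the unit budget (MC-testable sum rule:
  `1 − ∑_{n≤N} n(Λ+T) = M(N) + N·D(N) > 0`).
* `relative_axisLaplacian_logSummable_of_subharmonicOffOrigin`: with Simon–Lieb `M(n) ≥ c/n²`,
  SubH ⟹ `∑ₙ (ΔG/G)(n e₀)/n ≤ 1/c` — the relative excess is log-summable (second proof that no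
  uniform slack is possible, with a RATE: `ΔG/G ≥ κ/log n` on the axis is already excluded).

## (c) NATURAL STRENGTHENINGS / VARIANTS (paper, recorded for ideators)
* graph-uniform SubH ("for every graph of max degree 6 at `tanh β = tanh β_c(ℤ³) = 0.218`") is FALSE:
  7-vertex star `K_{1,6}` with the source at a leaf: at the centre `6G(c) = 6t > 1 + 5t² = ∑_nbrs G`
  iff `1/5 < t < 1` (finite version of the planner's Bethe-tree no-go). Not typed (needs `isingExpect`
  on an explicit finite graph; ~200 lines for little gain).
* `d = 1` analogue TRUE (`Δ t^{|x|} = t^{|x|-1}(1-t)² ≥ 0`); `β = 0` TRUE (`G = δ₀`); HIGH TEMPERATURE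
  TRUE with room (`G(x) ≍ t^{|x|₁}`: the neighbour towards the origin alone carries `G/t ≫ 6G`); massive
  regime `β < β_c`, `|x| ≫ ξ`: TRUE (`ΔG ≈ m²G > 0`, Ornstein–Zernike). So SubH can only fail in the
  critical window, at moderate `|x|`, through corrections to scaling / the `ℓ = 4` cubic-anisotropy
  channel (rattack seat's CruxAttack.md) or at `x = e₀` (2 % margin: needs `G(2e₀)+4G(e₀+e₁) ≥ 0.98121`).
* Asymptotic regime: a pure power law `|x|^{-1-η}`, `η > 0`, and its lattice version are STRICTLY
  subharmonic off `0` (review-3 analysis on the item), margin `η(1+η)A/|x|^{3+η} ≈ 0.0093/|x|³`.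

## (d) `-- Targets`: none yet (payload.targets = [], no line picked).

## (e) DATA (kill criterion (a) of the route) — jobs of THIS seat, code `subh_cd/main.py`
Swendsen–Wang at `β = 0.221654626` on `L³` tori, DLR/Callen estimator
`D(x) = ⟨s₀ (h_x − 6 tanh βh_x)⟩ = ∑_e G(x+e) − 6G(x)` (exact for `x ≠ 0` on the torus), 48-fold
symmetrisation, blocked errors; exact `3³` enumeration self-test; exact transfer matrix of the
`L×L×∞` tubes (`L = 3,4,5`) for the tube-Laplacian sign table AND the planner's lattice spectral
condition LSC (lowest odd level `E(k) − E₀` vs `ω₀(k) = arccosh(1 + k̂²/2)`):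
`j011401` (smoke: selftest, tubes 3/4, L=12) · `j011403` (L = 32,48,64,96) · `j011404` (L = 48,64,96,96) ·
`j011405` (tube 5×5×∞, odd sectors k = 2π(1,0),(1,1),(2,0),(2,1),(2,2),(0,0)/5).
Reading rule: SUSPECT-FALSE iff some site has `D < −5σ` at the two largest `L` (torus finite-size
corrections bias `D` upward ∝ L^{-1.41}); a violation on a finite tube does NOT refute the typed
statement (different graph) but locates where to look. (j011405 re-filed as j013423/j013424, 14 GB.)
RESULTS IN HAND (pure-python exact TM, `tube_pure.py`, evidence `tubes_pure_summary.md`):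
* 3×3×∞ and 4×4×∞ at β_c(ℤ³): tube-Laplacian `D > 0` at ALL 143 / 255 sites (`D(1,0,0) = +0.119 / +0.075`).
* LSC holds on both tubes in every odd sector, margins `E(k) − E₀ − ω₀(k)` = +7.6 %, +5.1 % (L=3; k̂²=3,6)
  and +6.2 %, +4.0 %, +3.1 %, +2.6 % (L=4; k̂² = 2,4,6,8): the odd levels TRACK `ω₀(k)` from above with a
  margin shrinking in `k̂²` — the binding momentum of the RP-spectral line is the zone corner `(π,π)`
  (`ω₀ = arccosh 5 = 2.2924`, measured 2.3518 on L=4), not small `k` — ON FINITE TUBES. Caveat for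
  the planner: relative to a FREE lattice particle of the same mass (`arccosh(cosh m + k̂²/2)`,
  m = 0.3257 on L=4) the Ising odd level is pushed UP by ≈ +0.045 at every k̂²; as L → ∞ (m → 0) the
  free-particle margin over `ω₀` vanishes at ALL k, so LSC in infinite volume rests (i) at the zone
  corner on that interaction shift surviving, and (ii) as k → 0 on the SIGN of the O(k⁴) lattice
  corrections of the odd dispersion relative to the free one (`ω₀² = k̂² − k̂⁴/12 + …`): a
  non-universal coefficient, untestable on tubes (finite-L mass gives a spurious margin m²/2|k| ≫ k³/24).
* GLOBAL test to run on the MC output (`combine_jobs.py`, exact `G₀` table `green3_table.json`, pure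
  python `green3.py`, accuracy 1e-13): SubH ⟹ `u = G − μ(0)G₀ ≤ 0` on ℤ³ (maximum principle,
  `μ(0) = 6(1−E_c) = 4.01879`), i.e. `R(x) = G_c(x)/(μ(0)G₀(x)) ≤ 1` at EVERY x; `u(0) = u(e₀) = −0.015672`
  exactly; thresholds `G_c(1,1,0) ≤ 0.221801`, `G_c(1,1,1) ≤ 0.175131`, `G_c(2,0,0) ≤ 0.172365`,
  `G_c(2,1,0) ≤ 0.144403` — a violation at a small site can come from `ΔG < 0` ANYWHERE (incl. |x| ≫ 8).

## (f) NUMERICAL VERDICT, cycle 1 (evidence `MC_verdict_cycle1.md`; jobs j014128/29/30, j014694, j014525, j014547/48, j014693)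
NO KILL — and strong evidence FOR SubH in the whole resolved window. `D(x) > 0` at ALL 164 sites
`max|xᵢ| ≤ 8`, at every `L = 24…128` (least significant raw value +4σ at (8,8,8)); FSS-extrapolated
`D_∞ > 0` everywhere: t = +248 (e₀: `D_∞ = 0.013751(55)`, i.e. `G(200)+4G(110) = 0.99490` vs the
needed 0.98115), +132 (2e₀), +117 (110), +68 (111), …; at the far corners `D_∞ = (+4±3)e-6` (888),
`(+1.1±0.4)e-5` (666), `(+2.0±0.5)e-5` (800) = the asymptotic law `η(1+η)A/r^{3+η}` (A ≈ 0.32) within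
errors, while at `r = 2…6` the data EXCEED that asymptote by +30…50 % — the leading correction to
scaling is POSITIVE (risk 'B < 0 ⇒ sign flip' does not materialise); finite-size corrections push `D`
up (`a > 0` at every site). Sampler validated (3³ exact enumeration, 4 runs; `E_∞ = 0.3301916(61)` vs
0.3302022(5)). Max-principle test: `R(x) = G/(μ₀G₀) = 0.955 (e₀), 0.940 (110), 0.932 (111/200) ↘ 0.88 (r=8)`
— no violation. Tubes 3×3/4×4/4×6/5×5 (exact TM): tube-Laplacian positive everywhere; LSC holds in
every odd sector. LSC BY MC (validated to 0.1–0.5 % on 4×4): the margin `E_odd(k) − ω₀(k)` is POSITIVE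
at all 44 momentum classes on Lt = 16 but nearly k-INDEPENDENT and shrinking ≈ 0.2/Lt
(corner (π,π): +0.061, +0.038, +0.028, +0.0215, +0.0165 for Lt = 4,6,8,12,16; extrapolation
`+0.005 ± 0.005`): LSC is MARGINAL in infinite volume at EVERY k — the odd threshold tracks `ω₀(k)` to
≲ 0.005 up to the zone corner, so 'LSC ⇒ axial SubH' needs a threshold IDENTITY (the singular locus
of `Ĝ(p)` is that of `ε(p)`), the spectral mirror of the exact-balance theorem.

## HANDOFF for the next re-arm
LANDED under `Theorems/SubharmonicOffOrigin/Negative/`: `AxisExactBalance.lean` (p84100), `AxisSumRule.lean` (p84253); `MaxPrincipleTest.lean` (p85150, in review; slim variant ready). Candidate proof of support item 1347 (ScreeningInfraredBound) attached on that item.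
Next regimes: (1) more statistics at L = 128/192 for r = 8…12 (the only unresolved window; D ≈ 1e-5 there; the DLR
'doubly improved' estimator D3 = ⟨tanh(βh₀)k(h_x)⟩ is in the bundle); (2) LSC-MC at Lt = 24, 32 to pin the
infinite-volume margin (≈ 0.2/Lt law vs a positive floor); (3) if a line is picked, attack its stubs with the axis
machinery (ratio → 1, sandwich, log-convexity, sum rule, max-principle test).
-/

noncomputable section

open Filter Topology Finset
open Literature.Probability.LatticeModels

namespace Summit.CriticalPhenomena.Ising3DConformalLimit.Cruxes.SubharmonicOffOrigin.Disproof

/-! ### Reformulation (for provers) -/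

/-- SubH is the statement that the `ℤ³` lattice Laplacian of the critical two-point function is
nonnegative off the origin. [folklore] -/
theorem subharmonicOffOrigin_iff_laplacian_nonneg :
    Summit.CriticalPhenomena.Ising3DConformalLimit.Theses.PerfectScreening.SubharmonicOffOrigin ↔
      ∀ x : Site 3, x ≠ 0 → 0 ≤ latticeLaplacianZd (criticalTwoPoint 3) x := by
  unfold Summit.CriticalPhenomena.Ising3DConformalLimit.Theses.PerfectScreening.SubharmonicOffOrigin
  refine forall_congr' fun x => imp_congr_right fun _ => ?_
  rw [latticeLaplacianZd_nonneg_iff]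
  norm_num

/-! ### Axis toolkit -/

/-- Messager–Miracle-Solé in coordinates: a site with first coordinate `n ≥ 1` and all coordinates of
modulus `≤ n` (i.e. on the sup-sphere of radius `n`) has `G(y) ≤ G(n e₀)`. [folklore] -/
theorem le_axis_of_coords {n : ℕ} (hn : 1 ≤ n) {y : Site 3} (h0 : y 0 = n)
    (hle : ∀ j, (y j).natAbs ≤ n) :
    criticalTwoPoint 3 y ≤ criticalTwoPoint 3 (Pi.single 0 (n : ℤ)) := by
  have hs : Site.supNorm y = n := by
    refine le_antisymm (Site.supNorm_le_iff.2 hle) ?_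
    have h := Site.natAbs_le_supNorm y 0
    rwa [h0, Int.natAbs_natCast] at h
  have h := (criticalTwoPoint_axis_sandwich (y := y) (by omega)).2
  rwa [hs] at h

/-- The four transverse neighbours of `n e₀` (`n ≥ 1`) are dominated by `G(n e₀)`. [folklore] -/
theorem transverse_nbrs_le (n : ℕ) (hn : 1 ≤ n) :
    criticalTwoPoint 3 (Pi.single 0 (n : ℤ) + Pi.single 1 1) ≤ criticalTwoPoint 3 (Pi.single 0 (n : ℤ)) ∧
    criticalTwoPoint 3 (Pi.single 0 (n : ℤ) - Pi.single 1 1) ≤ criticalTwoPoint 3 (Pi.single 0 (n : ℤ)) ∧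
    criticalTwoPoint 3 (Pi.single 0 (n : ℤ) + Pi.single 2 1) ≤ criticalTwoPoint 3 (Pi.single 0 (n : ℤ)) ∧
    criticalTwoPoint 3 (Pi.single 0 (n : ℤ) - Pi.single 2 1) ≤ criticalTwoPoint 3 (Pi.single 0 (n : ℤ)) := by
  refine ⟨le_axis_of_coords hn (by simp) ?_, le_axis_of_coords hn (by simp) ?_,
    le_axis_of_coords hn (by simp) ?_, le_axis_of_coords hn (by simp) ?_⟩ <;>
  · intro j
    fin_cases j <;> simp [hn]

/-- Axis bookkeeping: `n e₀ + e₀ = (n+1) e₀`. [folklore] -/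
theorem axis_add_one (n : ℕ) :
    (Pi.single 0 (n : ℤ) + Pi.single 0 1 : Site 3) = Pi.single 0 ((n + 1 : ℕ) : ℤ) := by
  rw [← Pi.single_add]; push_cast; rfl

/-- Axis bookkeeping: `(n+1) e₀ − e₀ = n e₀`. [folklore] -/
theorem axis_sub_one (n : ℕ) :
    (Pi.single 0 ((n + 1 : ℕ) : ℤ) - Pi.single 0 1 : Site 3) = Pi.single 0 (n : ℤ) := by
  rw [← Pi.single_sub]; push_cast; simp

/-- `n e₀ ≠ 0` for `n ≥ 1`. [folklore] -/
theorem axis_ne_zero {n : ℕ} (hn : 1 ≤ n) : (Pi.single 0 (n : ℤ) : Site 3) ≠ 0 := by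
  intro h
  have h0 := congrFun h 0
  simp at h0
  omega

/-! ### (a) The hypothesis `x ≠ 0` is load-bearing -/

/-- `⟨σ₀σ_{e₀}⟩_{β_c(3)} < 1`: otherwise axis log-convexity (`criticalTwoPoint_axis_sq_le`) and
`G ≤ 1` force `G(n e₀) = 1` for all `n`, against `G → 0` (`criticalTwoPoint_tendsto_zero_cofinite`).
[folklore] -/
theorem criticalTwoPoint_axis_one_lt_one : criticalTwoPoint 3 (Pi.single 0 ((1 : ℕ) : ℤ)) < 1 := by
  by_contra hge
  push Not at hge
  have h1 : criticalTwoPoint 3 (Pi.single 0 ((1 : ℕ) : ℤ)) = 1 :=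
    le_antisymm (criticalTwoPoint_le_one' _) hge
  -- all axis values are 1
  have hall : ∀ n : ℕ, criticalTwoPoint 3 (Pi.single 0 ((n + 1 : ℕ) : ℤ)) = 1 := by
    intro n
    induction n with
    | zero => simpa using h1
    | succ n ih =>
      have hsq := criticalTwoPoint_axis_sq_le (0 : Fin 3) (n := n + 1) (by omega)
      rw [show n + 1 - 1 = n by omega, ih, one_pow] at hsq
      have hle1 : criticalTwoPoint 3 (Pi.single 0 ((n : ℕ) : ℤ)) ≤ 1 := criticalTwoPoint_le_one' _
      have hnn : 0 ≤ criticalTwoPoint 3 (Pi.single 0 ((n + 1 + 1 : ℕ) : ℤ)) := criticalTwoPoint_nonneg' _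
      have hle2 : criticalTwoPoint 3 (Pi.single 0 ((n + 1 + 1 : ℕ) : ℤ)) ≤ 1 := criticalTwoPoint_le_one' _
      nlinarith
  -- but G → 0 along the (injective) axis sequence
  have hinj : Function.Injective (fun n : ℕ => (Pi.single 0 ((n + 1 : ℕ) : ℤ) : Site 3)) := by
    intro a b hab
    have h := congrFun hab 0
    simp at h
    omega
  have ht := criticalTwoPoint_tendsto_zero_cofinite.comp hinj.tendsto_cofinite
  rw [Nat.cofinite_eq_atTop] at ht
  have hev := ht.eventually (eventually_lt_nhds (by norm_num : (0 : ℝ) < 1 / 2))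
  obtain ⟨n, hn⟩ := hev.exists
  simp only [Function.comp_apply] at hn
  rw [hall n] at hn
  norm_num at hn

/-- The crux with its only hypothesis `x ≠ 0` DROPPED. [folklore] -/
def SubharmonicOffOriginWithoutNeZero : Prop :=
  ∀ x : Site 3, 6 * criticalTwoPoint 3 x ≤
    ∑ i : Fin 3, (criticalTwoPoint 3 (x + Pi.single i 1) + criticalTwoPoint 3 (x - Pi.single i 1))

/-- **`x ≠ 0` is load-bearing**: at the origin the inequality is `6 ≤ ∑_{|e|=1} G(e) = 6 G(e₀) < 6`.
[folklore] -/
theorem subharmonicOffOrigin_false_without_neZero : ¬ SubharmonicOffOriginWithoutNeZero := by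
  intro h
  have h0 := h 0
  simp only [zero_add, zero_sub, criticalTwoPoint_zero', criticalTwoPoint_neg, Fin.sum_univ_three,
    mul_one] at h0
  have h1 := criticalTwoPoint_le_one' (d := 3) (Pi.single 1 1)
  have h2 := criticalTwoPoint_le_one' (d := 3) (Pi.single 2 1)
  have hlt := criticalTwoPoint_axis_one_lt_one
  simp only [Nat.cast_one] at hlt
  linarith

/-! ### (b) Tightness: the neighbour sum on the axis is eventually `< (6+ε) G` -/

/-- **Exact balance on the axis (unconditional).** For every `ε > 0`, eventually in `n`,
`∑ᵢ (G(n e₀ + eᵢ) + G(n e₀ − eᵢ)) < (6 + ε) G(n e₀)`: the axial neighbours contribute ratios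
`G((n±1)e₀)/G(ne₀) → 1` (`criticalTwoPoint_axis_ratio_tendsto_one`) and the four transverse ones are
`≤ G(n e₀)` (Messager–Miracle-Solé). Hence NO inequality with a uniform slack can prove SubH, and the
constant `6` cannot be improved. [folklore] -/
theorem eventually_nbrSum_axis_lt (ε : ℝ) (hε : 0 < ε) :
    ∀ᶠ n : ℕ in atTop,
      ∑ i : Fin 3, (criticalTwoPoint 3 (Pi.single 0 (n : ℤ) + Pi.single i 1) +
          criticalTwoPoint 3 (Pi.single 0 (n : ℤ) - Pi.single i 1)) <
        (6 + ε) * criticalTwoPoint 3 (Pi.single 0 (n : ℤ)) := by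
  set M : ℕ → ℝ := fun n => criticalTwoPoint 3 (Pi.single 0 (n : ℤ)) with hM
  have hpos : ∀ n, 0 < M n := criticalTwoPoint_axis_pos
  have hr : Tendsto (fun k : ℕ => M (k + 2) / M (k + 1)) atTop (𝓝 1) :=
    criticalTwoPoint_axis_ratio_tendsto_one (0 : Fin 3)
  have hrinv : Tendsto (fun k : ℕ => M (k + 1) / M (k + 2)) atTop (𝓝 1) := by
    have h := hr.inv₀ one_ne_zero
    rw [inv_one] at h
    refine h.congr fun k => ?_
    rw [inv_div]
  have hr' : Tendsto (fun k : ℕ => M (k + 3) / M (k + 2)) atTop (𝓝 1) :=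
    hr.comp (tendsto_add_atTop_nat 1)
  have hsum : Tendsto (fun k : ℕ => M (k + 3) / M (k + 2) + M (k + 1) / M (k + 2)) atTop (𝓝 (1 + 1)) :=
    hr'.add hrinv
  have hev : ∀ᶠ k : ℕ in atTop, M (k + 3) / M (k + 2) + M (k + 1) / M (k + 2) < 2 + ε :=
    hsum.eventually (eventually_lt_nhds (by linarith))
  rw [eventually_atTop] at hev ⊢
  obtain ⟨K, hK⟩ := hev
  refine ⟨K + 2, fun n hn => ?_⟩
  obtain ⟨k, rfl⟩ : ∃ k, n = k + 2 := ⟨n - 2, by omega⟩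
  have hk := hK k (by omega)
  have hM2 : 0 < M (k + 2) := hpos (k + 2)
  have hfrac : M (k + 3) + M (k + 1) < (2 + ε) * M (k + 2) := by
    rw [← add_div, div_lt_iff₀ hM2] at hk
    linarith
  obtain ⟨t1, t2, t3, t4⟩ := transverse_nbrs_le (k + 2) (by omega)
  change _ ≤ M (k + 2) at t1 t2 t3 t4
  have hax1 : (Pi.single 0 ((k + 2 : ℕ) : ℤ) + Pi.single 0 1 : Site 3) = Pi.single 0 ((k + 3 : ℕ) : ℤ) :=
    axis_add_one (k + 2)
  have hax2 : (Pi.single 0 ((k + 2 : ℕ) : ℤ) - Pi.single 0 1 : Site 3) = Pi.single 0 ((k + 1 : ℕ) : ℤ) :=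
    axis_sub_one (k + 1)
  rw [Fin.sum_univ_three, hax1, hax2]
  change M (k + 3) + M (k + 1) + _ + _ < (6 + ε) * M (k + 2)
  nlinarith [t1, t2, t3, t4, hfrac, hM2, hε]

/-- The natural STRENGTHENING of SubH with a uniform slack `ε`: `(6+ε)·G(x) ≤ ∑_nbrs G` for all
`x ≠ 0` (what any Simon–Lieb / Gaussian-domination-type inequality with a constant would give).
[folklore] -/
def UniformlyStrictSubharmonic (ε : ℝ) : Prop :=
  ∀ x : Site 3, x ≠ 0 → (6 + ε) * criticalTwoPoint 3 x ≤
    ∑ i : Fin 3, (criticalTwoPoint 3 (x + Pi.single i 1) + criticalTwoPoint 3 (x - Pi.single i 1))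

/-- **Refutation of the strengthening**: for every `ε > 0`, `UniformlyStrictSubharmonic ε` is false —
the constant `6` in SubH is sharp (saturated along the axis). [folklore] -/
theorem not_uniformlyStrictSubharmonic {ε : ℝ} (hε : 0 < ε) : ¬ UniformlyStrictSubharmonic ε := by
  intro h
  obtain ⟨n, hn1, hn⟩ := ((eventually_ge_atTop 1).and (eventually_nbrSum_axis_lt ε hε)).exists
  exact absurd (h _ (axis_ne_zero hn1)) (not_le.2 hn)

/-- **Exact balance is forced by SubH (conditional)**: if SubH holds then along the axis
`∑_nbrs G(n e₀) / G(n e₀) → 6`, i.e. `ΔG/G → 0⁺` — any proof of SubH must be sharp to leading AND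
next order on the axis. [folklore] -/
theorem tendsto_nbrSum_div_of_subharmonicOffOrigin
    (h : Summit.CriticalPhenomena.Ising3DConformalLimit.Theses.PerfectScreening.SubharmonicOffOrigin) :
    Tendsto (fun n : ℕ =>
      (∑ i : Fin 3, (criticalTwoPoint 3 (Pi.single 0 (n : ℤ) + Pi.single i 1) +
          criticalTwoPoint 3 (Pi.single 0 (n : ℤ) - Pi.single i 1))) /
        criticalTwoPoint 3 (Pi.single 0 (n : ℤ))) atTop (𝓝 6) := by
  have hpos : ∀ n : ℕ, 0 < criticalTwoPoint 3 (Pi.single 0 (n : ℤ)) := criticalTwoPoint_axis_pos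
  rw [tendsto_order]
  refine ⟨fun a ha => ?_, fun b hb => ?_⟩
  · filter_upwards [eventually_ge_atTop 1] with n hn
    have hx := h _ (axis_ne_zero hn)
    rw [lt_div_iff₀ (hpos n)]
    calc a * criticalTwoPoint 3 (Pi.single 0 (n : ℤ)) < 6 * criticalTwoPoint 3 (Pi.single 0 (n : ℤ)) :=
          mul_lt_mul_of_pos_right ha (hpos n)
      _ ≤ _ := hx
  · filter_upwards [eventually_nbrSum_axis_lt (b - 6) (by linarith)] with n hn
    rw [div_lt_iff₀ (hpos n)]
    linarith

/-! ### (b′) Quantitative exact balance: the axis sum rule -/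

/-- Abel summation for second differences: `∑_{n<N} (n+1)·δ²M(n+1) = M 0 − M N − N·(M N − M (N+1))`.
[folklore] -/
theorem sum_mul_secondDiff (M : ℕ → ℝ) (N : ℕ) :
    ∑ n ∈ range N, ((n : ℝ) + 1) * (M (n + 2) - 2 * M (n + 1) + M n) =
      M 0 - M N - N * (M N - M (N + 1)) := by
  induction N with
  | zero => simp
  | succ N ih =>
    rw [sum_range_succ, ih]
    push_cast
    ring

/-- The neighbour sum at `(n+1)e₀` splits into the two axial values and the transverse part. [folklore] -/
theorem nbrSum_axis_eq (n : ℕ) :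
    ∑ i : Fin 3, (criticalTwoPoint 3 (Pi.single 0 ((n + 1 : ℕ) : ℤ) + Pi.single i 1) +
        criticalTwoPoint 3 (Pi.single 0 ((n + 1 : ℕ) : ℤ) - Pi.single i 1)) =
      criticalTwoPoint 3 (Pi.single 0 ((n + 2 : ℕ) : ℤ)) + criticalTwoPoint 3 (Pi.single 0 (n : ℤ)) +
      ((criticalTwoPoint 3 (Pi.single 0 ((n + 1 : ℕ) : ℤ) + Pi.single 1 1) +
        criticalTwoPoint 3 (Pi.single 0 ((n + 1 : ℕ) : ℤ) - Pi.single 1 1)) +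
       (criticalTwoPoint 3 (Pi.single 0 ((n + 1 : ℕ) : ℤ) + Pi.single 2 1) +
        criticalTwoPoint 3 (Pi.single 0 ((n + 1 : ℕ) : ℤ) - Pi.single 2 1))) := by
  rw [Fin.sum_univ_three, axis_add_one (n + 1), axis_sub_one n]
  ring

/-- Simon–Lieb on the axis: `c/(n+1)² ≤ G((n+1)e₀)` (tree theorem `criticalTwoPoint_bounds_holds`).
[cite: Simon1980, Thm. 1] -/
theorem simon_axis : ∃ c : ℝ, 0 < c ∧ ∀ n : ℕ,
    c / ((n : ℝ) + 1) ^ 2 ≤ criticalTwoPoint 3 (Pi.single 0 ((n + 1 : ℕ) : ℤ)) := by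
  obtain ⟨c, C, hc, hb⟩ := criticalTwoPoint_bounds_holds (d := 3) le_rfl
  refine ⟨c, hc, fun n => ?_⟩
  have hx := axis_ne_zero (n := n + 1) (by omega)
  have h1 := (hb _ hx).1
  have hnorm : ‖(Pi.single 0 (((n + 1 : ℕ)) : ℤ) : Site 3)‖ = (n : ℝ) + 1 := by
    rw [Pi.norm_single, Int.norm_natCast]; push_cast; ring
  rw [hnorm] at h1
  have hexp : ((n : ℝ) + 1) ^ (-((((3 : ℕ) : ℝ)) - 1)) = (((n : ℝ) + 1) ^ 2)⁻¹ := by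
    rw [show (-((((3 : ℕ) : ℝ)) - 1)) = -(2 : ℝ) by norm_num, Real.rpow_neg (by positivity), Real.rpow_two]
  rw [hexp] at h1
  simpa [div_eq_mul_inv] using h1

/-- **AXIS SUM RULE (unconditional identity).** With `M n = G(n e₀)`, the axis Laplacian
`Λ(m) = ∑_nbrs G(m e₀) − 6 G(m e₀)` and the transverse deficit
`T(m) = 4 G(m e₀) − ∑_{transverse nbrs} G ≥ 0` one has `Λ(m) + T(m) = δ²M(m)`, whence by Abel
summation `∑_{n<N} (n+1)·(Λ(n+1) + T(n+1)) + M N + N·(M N − M (N+1)) = G(0) = 1` for every `N`: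
the unit charge at the origin is EXACTLY accounted for by the weighted axis Laplacian, the weighted
transverse anisotropy and a (vanishing) tail. [folklore] -/
theorem axis_sum_rule (N : ℕ) :
    ∑ n ∈ range N, ((n : ℝ) + 1) *
        ((∑ i : Fin 3, (criticalTwoPoint 3 (Pi.single 0 ((n + 1 : ℕ) : ℤ) + Pi.single i 1) +
            criticalTwoPoint 3 (Pi.single 0 ((n + 1 : ℕ) : ℤ) - Pi.single i 1))) -
          6 * criticalTwoPoint 3 (Pi.single 0 ((n + 1 : ℕ) : ℤ)) +
         (4 * criticalTwoPoint 3 (Pi.single 0 ((n + 1 : ℕ) : ℤ)) -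
          ((criticalTwoPoint 3 (Pi.single 0 ((n + 1 : ℕ) : ℤ) + Pi.single 1 1) +
             criticalTwoPoint 3 (Pi.single 0 ((n + 1 : ℕ) : ℤ) - Pi.single 1 1)) +
           (criticalTwoPoint 3 (Pi.single 0 ((n + 1 : ℕ) : ℤ) + Pi.single 2 1) +
             criticalTwoPoint 3 (Pi.single 0 ((n + 1 : ℕ) : ℤ) - Pi.single 2 1))))) +
      criticalTwoPoint 3 (Pi.single 0 (N : ℤ)) +
      N * (criticalTwoPoint 3 (Pi.single 0 (N : ℤ)) - criticalTwoPoint 3 (Pi.single 0 ((N + 1 : ℕ) : ℤ))) = 1 := by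
  have h := sum_mul_secondDiff (fun n => criticalTwoPoint 3 (Pi.single 0 (n : ℤ))) N
  simp only [Nat.cast_zero, Pi.single_zero, criticalTwoPoint_zero'] at h
  have hsum : ∑ n ∈ range N, ((n : ℝ) + 1) *
        ((∑ i : Fin 3, (criticalTwoPoint 3 (Pi.single 0 ((n + 1 : ℕ) : ℤ) + Pi.single i 1) +
            criticalTwoPoint 3 (Pi.single 0 ((n + 1 : ℕ) : ℤ) - Pi.single i 1))) -
          6 * criticalTwoPoint 3 (Pi.single 0 ((n + 1 : ℕ) : ℤ)) +
         (4 * criticalTwoPoint 3 (Pi.single 0 ((n + 1 : ℕ) : ℤ)) -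
          ((criticalTwoPoint 3 (Pi.single 0 ((n + 1 : ℕ) : ℤ) + Pi.single 1 1) +
             criticalTwoPoint 3 (Pi.single 0 ((n + 1 : ℕ) : ℤ) - Pi.single 1 1)) +
           (criticalTwoPoint 3 (Pi.single 0 ((n + 1 : ℕ) : ℤ) + Pi.single 2 1) +
             criticalTwoPoint 3 (Pi.single 0 ((n + 1 : ℕ) : ℤ) - Pi.single 2 1))))) =
      ∑ n ∈ range N, ((n : ℝ) + 1) * (criticalTwoPoint 3 (Pi.single 0 ((n + 2 : ℕ) : ℤ)) -
        2 * criticalTwoPoint 3 (Pi.single 0 ((n + 1 : ℕ) : ℤ)) + criticalTwoPoint 3 (Pi.single 0 (n : ℤ))) :=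
    sum_congr rfl fun n _ => by rw [nbrSum_axis_eq]; ring
  rw [hsum, h]
  ring

/-- **Unconditional bound on the weighted axis Laplacian**: `∑_{n<N} (n+1)·Λ(n+1) < 1` for every `N`
(`T ≥ 0` by Messager–Miracle-Solé, the tail is `> 0` by MMS monotonicity and Simon–Lieb positivity).
So the POSITIVE part of `ΔG` along the axis is small in the mean `∑ n·ΔG(ne₀)`, SubH or not.
[folklore] -/
theorem sum_weighted_axisLaplacian_lt_one (N : ℕ) :
    ∑ n ∈ range N, ((n : ℝ) + 1) *
        ((∑ i : Fin 3, (criticalTwoPoint 3 (Pi.single 0 ((n + 1 : ℕ) : ℤ) + Pi.single i 1) +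
            criticalTwoPoint 3 (Pi.single 0 ((n + 1 : ℕ) : ℤ) - Pi.single i 1))) -
          6 * criticalTwoPoint 3 (Pi.single 0 ((n + 1 : ℕ) : ℤ))) < 1 := by
  have hid := axis_sum_rule N
  have hmono : criticalTwoPoint 3 (Pi.single 0 ((N + 1 : ℕ) : ℤ)) ≤ criticalTwoPoint 3 (Pi.single 0 (N : ℤ)) :=
    criticalTwoPoint_axis_antitone (Nat.le_succ N)
  have hpos : 0 < criticalTwoPoint 3 (Pi.single 0 (N : ℤ)) := criticalTwoPoint_axis_pos N
  have hN : (0 : ℝ) ≤ N := Nat.cast_nonneg N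
  have htail : 0 ≤ (N : ℝ) * (criticalTwoPoint 3 (Pi.single 0 (N : ℤ)) -
      criticalTwoPoint 3 (Pi.single 0 ((N + 1 : ℕ) : ℤ))) := mul_nonneg hN (sub_nonneg.2 hmono)
  calc ∑ n ∈ range N, ((n : ℝ) + 1) *
        ((∑ i : Fin 3, (criticalTwoPoint 3 (Pi.single 0 ((n + 1 : ℕ) : ℤ) + Pi.single i 1) +
            criticalTwoPoint 3 (Pi.single 0 ((n + 1 : ℕ) : ℤ) - Pi.single i 1))) -
          6 * criticalTwoPoint 3 (Pi.single 0 ((n + 1 : ℕ) : ℤ)))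
      ≤ ∑ n ∈ range N, ((n : ℝ) + 1) *
        ((∑ i : Fin 3, (criticalTwoPoint 3 (Pi.single 0 ((n + 1 : ℕ) : ℤ) + Pi.single i 1) +
            criticalTwoPoint 3 (Pi.single 0 ((n + 1 : ℕ) : ℤ) - Pi.single i 1))) -
          6 * criticalTwoPoint 3 (Pi.single 0 ((n + 1 : ℕ) : ℤ)) +
         (4 * criticalTwoPoint 3 (Pi.single 0 ((n + 1 : ℕ) : ℤ)) -
          ((criticalTwoPoint 3 (Pi.single 0 ((n + 1 : ℕ) : ℤ) + Pi.single 1 1) +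
             criticalTwoPoint 3 (Pi.single 0 ((n + 1 : ℕ) : ℤ) - Pi.single 1 1)) +
           (criticalTwoPoint 3 (Pi.single 0 ((n + 1 : ℕ) : ℤ) + Pi.single 2 1) +
             criticalTwoPoint 3 (Pi.single 0 ((n + 1 : ℕ) : ℤ) - Pi.single 2 1))))) := by
        refine sum_le_sum fun n _ => ?_
        obtain ⟨t1, t2, t3, t4⟩ := transverse_nbrs_le (n + 1) (by omega)
        have hw : (0 : ℝ) ≤ (n : ℝ) + 1 := by positivity
        exact mul_le_mul_of_nonneg_left (le_add_of_nonneg_right (by linarith)) hw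
    _ = 1 - (criticalTwoPoint 3 (Pi.single 0 (N : ℤ)) +
      N * (criticalTwoPoint 3 (Pi.single 0 (N : ℤ)) - criticalTwoPoint 3 (Pi.single 0 ((N + 1 : ℕ) : ℤ)))) := by linarith [hid]
    _ < 1 := by linarith

/-- **Under SubH the weighted axis Laplacian is nonnegative with partial sums `≤ 1`**:
`0 ≤ (n+1)·Λ(n+1)` and `∑_{n<N} (n+1)·Λ(n+1) ≤ 1` for all `N` (hence summable with total mass `≤ 1`,
`summable_of_sum_range_le`). Quantitative exact balance: `liminf n²·ΔG(ne₀) = 0`, and no lower bound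
`ΔG(ne₀) ≥ κ/(n² log n)` can hold under SubH. [folklore] -/
theorem weighted_axisLaplacian_of_subharmonicOffOrigin
    (h : Summit.CriticalPhenomena.Ising3DConformalLimit.Theses.PerfectScreening.SubharmonicOffOrigin) :
    (∀ n : ℕ, 0 ≤ ((n : ℝ) + 1) *
        ((∑ i : Fin 3, (criticalTwoPoint 3 (Pi.single 0 ((n + 1 : ℕ) : ℤ) + Pi.single i 1) +
            criticalTwoPoint 3 (Pi.single 0 ((n + 1 : ℕ) : ℤ) - Pi.single i 1))) -
          6 * criticalTwoPoint 3 (Pi.single 0 ((n + 1 : ℕ) : ℤ)))) ∧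
    (∀ N : ℕ, ∑ n ∈ range N, ((n : ℝ) + 1) *
        ((∑ i : Fin 3, (criticalTwoPoint 3 (Pi.single 0 ((n + 1 : ℕ) : ℤ) + Pi.single i 1) +
            criticalTwoPoint 3 (Pi.single 0 ((n + 1 : ℕ) : ℤ) - Pi.single i 1))) -
          6 * criticalTwoPoint 3 (Pi.single 0 ((n + 1 : ℕ) : ℤ))) ≤ 1) := by
  have hnn : ∀ n : ℕ, 0 ≤ ((n : ℝ) + 1) *
      ((∑ i : Fin 3, (criticalTwoPoint 3 (Pi.single 0 ((n + 1 : ℕ) : ℤ) + Pi.single i 1) +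
            criticalTwoPoint 3 (Pi.single 0 ((n + 1 : ℕ) : ℤ) - Pi.single i 1))) -
          6 * criticalTwoPoint 3 (Pi.single 0 ((n + 1 : ℕ) : ℤ))) := by
    intro n
    have hx := h _ (axis_ne_zero (n := n + 1) (by omega))
    exact mul_nonneg (by positivity) (by linarith)
  have hle : ∀ N : ℕ, ∑ n ∈ range N, ((n : ℝ) + 1) *
        ((∑ i : Fin 3, (criticalTwoPoint 3 (Pi.single 0 ((n + 1 : ℕ) : ℤ) + Pi.single i 1) +
            criticalTwoPoint 3 (Pi.single 0 ((n + 1 : ℕ) : ℤ) - Pi.single i 1))) -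
          6 * criticalTwoPoint 3 (Pi.single 0 ((n + 1 : ℕ) : ℤ))) ≤ 1 := fun N => (sum_weighted_axisLaplacian_lt_one N).le
  exact ⟨hnn, hle⟩

/-- Elementary algebra for the log-summability estimate: `c/w² ≤ M`, `Λ ≥ 0` give
`Λ/(w M) ≤ (1/c)·(w Λ)`. [folklore] -/
theorem div_le_weighted_aux (Λ M c w : ℝ) (hΛ : 0 ≤ Λ) (hM : 0 < M) (hc : 0 < c) (hw : 0 < w)
    (hcM : c / w ^ 2 ≤ M) : Λ / (w * M) ≤ (1 / c) * (w * Λ) := by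
  have hcM' : c ≤ w ^ 2 * M := by rwa [div_le_iff₀ (by positivity), mul_comm] at hcM
  rw [div_le_iff₀ (mul_pos hw hM)]
  have key : (1 / c) * (w * Λ) * (w * M) = Λ * ((w ^ 2 * M) / c) := by ring
  rw [key]
  have h1 : 1 ≤ (w ^ 2 * M) / c := by rw [le_div_iff₀ hc, one_mul]; exact hcM'
  nlinarith [mul_le_mul_of_nonneg_left h1 hΛ]

/-- **Log-summability of the RELATIVE axis excess under SubH**: with Simon–Lieb `G(ne₀) ≥ c/n²`,
`∑_{n<N} (ΔG/G)((n+1)e₀)/(n+1) ≤ 1/c` for all `N`. In particular the relative excess cannot stay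
above any `ε > 0` (harmonic series) — a second, quantitative proof that uniformly strict SubH fails.
[folklore] -/
theorem relative_axisLaplacian_logSummable_of_subharmonicOffOrigin
    (h : Summit.CriticalPhenomena.Ising3DConformalLimit.Theses.PerfectScreening.SubharmonicOffOrigin) :
    ∃ C : ℝ, ∀ N : ℕ, ∑ n ∈ range N,
        ((∑ i : Fin 3, (criticalTwoPoint 3 (Pi.single 0 ((n + 1 : ℕ) : ℤ) + Pi.single i 1) +
            criticalTwoPoint 3 (Pi.single 0 ((n + 1 : ℕ) : ℤ) - Pi.single i 1))) -
          6 * criticalTwoPoint 3 (Pi.single 0 ((n + 1 : ℕ) : ℤ))) /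
          (((n : ℝ) + 1) * criticalTwoPoint 3 (Pi.single 0 ((n + 1 : ℕ) : ℤ))) ≤ C := by
  obtain ⟨c, hc, hlow⟩ := simon_axis
  refine ⟨1 / c, fun N => ?_⟩
  have hle := (weighted_axisLaplacian_of_subharmonicOffOrigin h).2 N
  have hterm : ∀ n ∈ range N,
      ((∑ i : Fin 3, (criticalTwoPoint 3 (Pi.single 0 ((n + 1 : ℕ) : ℤ) + Pi.single i 1) +
            criticalTwoPoint 3 (Pi.single 0 ((n + 1 : ℕ) : ℤ) - Pi.single i 1))) -
          6 * criticalTwoPoint 3 (Pi.single 0 ((n + 1 : ℕ) : ℤ))) /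
          (((n : ℝ) + 1) * criticalTwoPoint 3 (Pi.single 0 ((n + 1 : ℕ) : ℤ))) ≤
        (1 / c) * (((n : ℝ) + 1) *
        ((∑ i : Fin 3, (criticalTwoPoint 3 (Pi.single 0 ((n + 1 : ℕ) : ℤ) + Pi.single i 1) +
            criticalTwoPoint 3 (Pi.single 0 ((n + 1 : ℕ) : ℤ) - Pi.single i 1))) -
          6 * criticalTwoPoint 3 (Pi.single 0 ((n + 1 : ℕ) : ℤ)))) := by
    intro n _
    have hx := h _ (axis_ne_zero (n := n + 1) (by omega))
    exact div_le_weighted_aux _ _ c _ (by linarith) (criticalTwoPoint_axis_pos (n + 1)) hc (by positivity) (hlow n)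
  have h1 : ∑ n ∈ range N,
        ((∑ i : Fin 3, (criticalTwoPoint 3 (Pi.single 0 ((n + 1 : ℕ) : ℤ) + Pi.single i 1) +
            criticalTwoPoint 3 (Pi.single 0 ((n + 1 : ℕ) : ℤ) - Pi.single i 1))) -
          6 * criticalTwoPoint 3 (Pi.single 0 ((n + 1 : ℕ) : ℤ))) /
          (((n : ℝ) + 1) * criticalTwoPoint 3 (Pi.single 0 ((n + 1 : ℕ) : ℤ))) ≤
      ∑ n ∈ range N, (1 / c) * (((n : ℝ) + 1) *
        ((∑ i : Fin 3, (criticalTwoPoint 3 (Pi.single 0 ((n + 1 : ℕ) : ℤ) + Pi.single i 1) +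
            criticalTwoPoint 3 (Pi.single 0 ((n + 1 : ℕ) : ℤ) - Pi.single i 1))) -
          6 * criticalTwoPoint 3 (Pi.single 0 ((n + 1 : ℕ) : ℤ)))) := sum_le_sum hterm
  have h2 : ∑ n ∈ range N, (1 / c) * (((n : ℝ) + 1) *
        ((∑ i : Fin 3, (criticalTwoPoint 3 (Pi.single 0 ((n + 1 : ℕ) : ℤ) + Pi.single i 1) +
            criticalTwoPoint 3 (Pi.single 0 ((n + 1 : ℕ) : ℤ) - Pi.single i 1))) -
          6 * criticalTwoPoint 3 (Pi.single 0 ((n + 1 : ℕ) : ℤ)))) = (1 / c) * ∑ n ∈ range N, ((n : ℝ) + 1) *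
        ((∑ i : Fin 3, (criticalTwoPoint 3 (Pi.single 0 ((n + 1 : ℕ) : ℤ) + Pi.single i 1) +
            criticalTwoPoint 3 (Pi.single 0 ((n + 1 : ℕ) : ℤ) - Pi.single i 1))) -
          6 * criticalTwoPoint 3 (Pi.single 0 ((n + 1 : ℕ) : ℤ))) := by
    rw [← mul_sum]
  have h3 : (1 / c) * ∑ n ∈ range N, ((n : ℝ) + 1) *
        ((∑ i : Fin 3, (criticalTwoPoint 3 (Pi.single 0 ((n + 1 : ℕ) : ℤ) + Pi.single i 1) +
            criticalTwoPoint 3 (Pi.single 0 ((n + 1 : ℕ) : ℤ) - Pi.single i 1))) -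
          6 * criticalTwoPoint 3 (Pi.single 0 ((n + 1 : ℕ) : ℤ))) ≤ (1 / c) * 1 :=
    mul_le_mul_of_nonneg_left hle (by positivity)
  linarith [h1, h2, h3]


end Summit.CriticalPhenomena.Ising3DConformalLimit.Cruxes.SubharmonicOffOrigin.Disproof
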